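import Summits.HubbardSuperconductivity.HubbardSuperconductivity.Theorems.TwSourcedCondensation.Negative.UniformThreshold

/-!
# Crux `TwSourcedCondensation` (item `stmt-HubbardSuperconductivity-1697`): the hypothesis `-4 < μ₁` is
load-bearing (below the band there is no Cooper logarithm)

`--supports` file of the standing disprover (generation 3); no definition introduced. Below the band bottom
(`μ ≤ -4 - γ`) EVERY free level of EVERY torus avoids `μ` by `γ` (`ε_L(k) ≥ -4`), so the `β`-uniform cap of
`UniformThreshold` holds with an `L`-independent gap and the crux's witness needs no control of `L₀` at all:

* `levelGap_belowBand` — `γ ≤ |ε_L(k) - μ|` for all `L, k` once `μ ≤ -4 - γ`;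
* `twSourcedCondensation_false_belowBand` — the crux with the band hypothesis `-4 < μ₁` dropped is FALSE
  (witness `μ₁ = μ₂ = -5`, `β = 1/U`, `h = √U`, `U = min(U₀,1,h₀²,a²/4,e^{-M-1})`, `M = 2(34 + C + c log 2)/c`):
  any proof of the crux must use that `μ` lies inside the band;
* `stub_freeLinearCooperLog_false_belowBand` — likewise for the lead's free stub (F) (`μ₁ = μ₂ = -5`,
  `β = exp((32 + C₀)/c₀ + 1)`, `h = 1/β`): its hypothesis `-4 < μ₁` is load-bearing too (`ρ_d = 0` below the band).
Tree: `neg_four_le_torusBand`, `levelGap_obstruction`, `free_gain_le_of_levelGap`, `one_div_le_exp_div` (`UniformThreshold`).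
-/

noncomputable section

namespace Summit.HubbardSuperconductivity.HubbardSuperconductivity.Theorems.TwSourcedCondensation.Negative

open Matrix Finset Literature.MathematicalPhysics.QuantumLattice Literature.Probability.LatticeModels
open Summit.HubbardSuperconductivity.HubbardSuperconductivity.Theorems
open scoped Matrix.Norms.L2Operator ComplexOrder

/-- Below the band every free level of every torus avoids `μ` by `γ`: `μ ≤ -4 - γ` gives `γ ≤ |ε_L(k) - μ|`
(`ε_L(k) ≥ -4`). [folklore] -/
theorem levelGap_belowBand (L : ℕ) {μ γ : ℝ} (hμ : μ ≤ -4 - γ) (k : TorusSite 2 L) :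
    γ ≤ |torusBand L k - μ| := by
  have h4 := neg_four_le_torusBand L k
  have h1 : γ ≤ torusBand L k - μ := by linarith
  exact h1.trans (le_abs_self _)

/-- **The band hypothesis `-4 < μ₁` is LOAD-BEARING in the crux.** With it dropped (interval `[-5,-5]` below the
band bottom) the statement is FALSE: all free levels avoid `μ = -5` by `γ = 1` on EVERY torus, so the response is
`≤ (32 + 2)h²` at `β = 1/U`, `h = √U` whatever `L₀(U,β,μ)` is (`levelGap_obstruction`), while the floor is
`h²(c(½ log(1/U) - log 2) - C)`. Below the band `ρ_d(μ) = 0`: there is no Cooper logarithm. [folklore] -/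
theorem twSourcedCondensation_false_belowBand :
    ¬ (∀ μ₁ μ₂ : ℝ, μ₁ ≤ μ₂ → μ₂ < 0 → ∃ U₀ a c C h₀ : ℝ, 0 < U₀ ∧ 0 < a ∧ 0 < c ∧ 0 < C ∧ 0 < h₀ ∧
      ∀ U : ℝ, 0 < U → U ≤ U₀ → ∀ β : ℝ, 1 ≤ β → β ≤ Real.exp (a / U) →
      ∀ μ ∈ Set.Icc μ₁ μ₂, ∃ L₀ : ℕ, ∀ (L : ℕ) [NeZero L], L₀ ≤ L → ∀ h : ℝ, |h| ≤ h₀ →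
        c * h ^ 2 * Real.log (1 / (|h| + 1 / β)) - C * h ^ 2 ≤
          Real.log (partitionFn β (dWaveSourceTorus L U μ h)).re / (β * (L : ℝ) ^ 2) -
            Real.log (partitionFn β (dWaveSourceTorus L U μ 0)).re / (β * (L : ℝ) ^ 2)) := by
  intro H
  obtain ⟨U₀, a, c, C, h₀, hU₀, ha, hc, hC, hh₀, H⟩ := H (-5) (-5) le_rfl (by norm_num)
  have hlog2 : 0 < Real.log 2 := Real.log_pos one_lt_two
  set A : ℝ := 32 / 1 + 2 with hA
  have hA0 : 0 ≤ A := by positivity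
  set M : ℝ := 2 * (A + C + c * Real.log 2) / c with hM
  have hM0 : 0 ≤ M := by positivity
  set U : ℝ := min U₀ (min (min 1 (h₀ ^ 2)) (min (a ^ 2 / 4) (Real.exp (-M - 1)))) with hU
  have hUpos : 0 < U := by positivity
  have hUU₀ : U ≤ U₀ := min_le_left _ _
  have hU1 : U ≤ 1 := (min_le_right _ _).trans ((min_le_left _ _).trans (min_le_left _ _))
  have hU2 : U ≤ h₀ ^ 2 := (min_le_right _ _).trans ((min_le_left _ _).trans (min_le_right _ _))
  have hU3 : U ≤ a ^ 2 / 4 := (min_le_right _ _).trans ((min_le_right _ _).trans (min_le_left _ _))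
  have hU4 : U ≤ Real.exp (-M - 1) := (min_le_right _ _).trans ((min_le_right _ _).trans (min_le_right _ _))
  have hβ1 : 1 ≤ 1 / U := by rw [le_div_iff₀ hUpos, one_mul]; exact hU1
  have hβexp : 1 / U ≤ Real.exp (a / U) := one_div_le_exp_div hUpos ha.le hU3
  have hhh₀ : |Real.sqrt U| ≤ h₀ := by
    rw [abs_of_nonneg (Real.sqrt_nonneg U), ← Real.sqrt_sq hh₀.le]
    exact Real.sqrt_le_sqrt hU2
  obtain ⟨L₀, hL₀⟩ := H U hUpos hUU₀ (1 / U) hβ1 hβexp (-5) ⟨le_rfl, le_rfl⟩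
  set L : ℕ := max L₀ 3 with hLdef
  have hL3 : 3 ≤ L := le_max_right _ _
  have hLL₀ : L₀ ≤ L := le_max_left _ _
  haveI : NeZero L := ⟨by omega⟩
  have hgap : ∀ k : TorusSite 2 L, (1 : ℝ) ≤ |torusBand L k - (-5)| :=
    fun k => levelGap_belowBand L (by norm_num) k
  have key := hL₀ L hLL₀ (Real.sqrt U) hhh₀
  have core := levelGap_obstruction hL3 one_pos hgap hUpos hU1 hc key
  have hlogU : M + 1 ≤ Real.log (1 / U) := by
    have h2 : Real.log U ≤ -M - 1 := by
      rw [← Real.log_exp (-M - 1)]; exact Real.log_le_log hUpos hU4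
    rw [one_div, Real.log_inv]
    linarith
  have hc0 : c ≠ 0 := hc.ne'
  have hcM : c * M / 2 = A + C + c * Real.log 2 := by
    rw [hM]; field_simp
  have h1 : c * (M + 1) ≤ c * Real.log (1 / U) := mul_le_mul_of_nonneg_left hlogU hc.le
  have hA' : (32 : ℝ) / 1 + 2 = A := rfl
  linarith

/-- **The band hypothesis is load-bearing in the lead's free stub (F) too**: with `μ₁ = μ₂ = -5` the free
response is `≤ 32h²` for every `β` and every `L ≥ 3` (`free_gain_le_of_levelGap`, gap `1`), while the stub's floor at
`h = 1/β` is `(c₀ log β - C₀)/β²`. [folklore] -/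
theorem stub_freeLinearCooperLog_false_belowBand :
    ¬ (∀ μ₁ μ₂ : ℝ, μ₁ ≤ μ₂ → μ₂ < 0 → ∃ c₀ C₀ : ℝ, 0 < c₀ ∧ 0 < C₀ ∧ ∀ β : ℝ, 1 ≤ β →
      ∀ μ ∈ Set.Icc μ₁ μ₂, ∃ L₀ : ℕ, ∀ (L : ℕ) [NeZero L], L₀ ≤ L → ∀ h : ℝ, |h| ≤ 1 / β →
        c₀ * h ^ 2 * Real.log β - C₀ * h ^ 2 ≤
          Real.log (partitionFn β (dWaveSourceTorus L 0 μ h)).re / (β * (L : ℝ) ^ 2) -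
            Real.log (partitionFn β (dWaveSourceTorus L 0 μ 0)).re / (β * (L : ℝ) ^ 2)) := by
  intro H
  obtain ⟨c₀, C₀, hc₀, hC₀, H⟩ := H (-5) (-5) le_rfl (by norm_num)
  set β : ℝ := Real.exp ((32 / 1 + C₀) / c₀ + 1) with hβ
  have hβpos : 0 < β := Real.exp_pos _
  have hβ1 : 1 ≤ β := Real.one_le_exp (by positivity)
  obtain ⟨L₀, hL₀⟩ := H β hβ1 (-5) ⟨le_rfl, le_rfl⟩
  set L : ℕ := max L₀ 3 with hLdef
  have hL3 : 3 ≤ L := le_max_right _ _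
  have hLL₀ : L₀ ≤ L := le_max_left _ _
  haveI : NeZero L := ⟨by omega⟩
  have hgap : ∀ k : TorusSite 2 L, (1 : ℝ) ≤ |torusBand L k - (-5)| :=
    fun k => levelGap_belowBand L (by norm_num) k
  have key := hL₀ L hLL₀ (1 / β) (by rw [abs_of_pos (one_div_pos.2 hβpos)])
  have hcap := free_gain_le_of_levelGap hL3 one_pos hgap hβpos (1 / β)
  have hlogβ : Real.log β = (32 / 1 + C₀) / c₀ + 1 := by rw [hβ, Real.log_exp]
  rw [hlogβ] at key
  have hh2 : 0 < (1 / β) ^ 2 := by positivity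
  have hc0 : c₀ ≠ 0 := hc₀.ne'
  have e : c₀ * ((32 / 1 + C₀) / c₀ + 1) - C₀ = 32 / 1 + c₀ := by field_simp; ring
  have : (c₀ * ((32 / 1 + C₀) / c₀ + 1) - C₀) * (1 / β) ^ 2 ≤ 32 / 1 * (1 / β) ^ 2 := by
    have e2 : 32 * (1 / β) ^ 2 / 1 = 32 / 1 * (1 / β) ^ 2 := by ring
    nlinarith
  rw [e] at this
  nlinarith [mul_pos hc₀ hh2]

end Summit.HubbardSuperconductivity.HubbardSuperconductivity.Theorems.TwSourcedCondensation.Negative
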